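import Literature.MathematicalPhysics.QuantumFieldTheory.Balaban1983to89.B6DomainChangeP2134Sizes
import Literature.MathematicalPhysics.QuantumFieldTheory.Balaban1983to89.B8Ineq192MultiLevelTorus
import HarnessLib

/-!
# `Balaban1983to89.B6Line3ProfileV1` — T. Bałaban, *Propagators and renormalization transformations for lattice gauge theories. II*,
# Commun. Math. Phys. **96** (1984) 223–250 [Balaban1984PropagatorsII], Lemma 2.1 (2.61) p. 234 and p. 238: THE PROFILE `K_p` OF THE TORUS DISTANCE
# (2.46) FROM LEMMA 2.1, AND THE ABSORPTION OF THE LINE-3 CONSTANT `C_D(K_x)` INTO `e^{−cM}` — bookkeeping for the line-3 input of Prop. 2.6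

statement-level skeleton of published theorems with citation tags; proofs where landed; nothing here is a claim about the Yang–Mills mass gap

PDF held: `paper:balaban1984-cmp96-propagators-rt-ii` (journal page = PDF page + 222): p. 234 [PDF 12] (Lemma 2.1, (2.61): *"sup_y Σ_{y′∈𝔅} e^{−αδ₀d(y,y′)}
≤ c₁(α)"*), p. 233 [PDF 11] ((2.59)), p. 238 [PDF 16] (*"an estimate has the factor e^{−δ₀M} … gives a factor O(M⁻¹)"*).

CITATION HEADER (lean-in-tree rule) — WHAT IS REPRODUCED.  Phase-2 file of the `lit-balaban` typed skeleton (HOME `run/shared/lean/pub/lit-balaban/`),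
unit `lit-balaban-r03` (B6 fold owner; r03 gen 22, literature-prover-lit-balaban-r03-g22-0), referee ref-4.  SKELETON rows **B6.Lem2.1** × **B6.Prop2.6** ×
B6.Eq2.92 (cells; decls of record untouched).  Input of B6-CLOSURE §5 item 16: the binders `Kp`/`hPrT`/`hKp0`/`hKanti` of p22's
`…B6Line3WindowV1.line3_window` and the absorption of its constant `CDgk(…, K_p(1), K_p(δ′/192)·(1 + #𝔅(T_□)))·e^{−δ′M₀/96}` into `C_D·e^{−c_D M}`.
IMPORTS BY NAME, restating nothing: `…B6Geom246MultiLevelTorus` (p21: `geomT`, **`lemma21_torus`**), `…B6Ineq261LevelGap` (p29: `K261`, `K261_nonneg`),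
`…B6DomainChange` (p38: `Profile`), `…B6DomainChangeP2134Sizes` (p38: `CDgk`, `CDtot`), `…B8Ineq192MultiLevelTorus` (r05: `geomTB`).

## WHAT THIS FILE CERTIFIES (kernel-checked, 0 sorry, standard axioms; THEOREMS ONLY — no `def`, no new named fact)

* `budget_of_rate` — the (2.59)-shape threshold `e^{−a₀}·L^{2(d+1)/N₃} < 1` holds for `N₃ := ⌈2(d+1)·log L/a₀⌉₊ + 1`.
* `profile_torus` — **THE TORUS PROFILE**: under the Lemma-2.1 budget at rate `a₀`, the function `K_p(a) := K₂₆₁` for `a ≥ a₀`, `:= max(K₂₆₁, #𝔅)` below,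
  is a `Profile` of `(geomTB D).dist` (every `Σ_b e^{−a d_T(s,b)} ≤ K_p(a)`), non-negative and antitone on `a > 0` — the binders `hPrT`, `hKp0`, `hKanti`.
* `CDgk_mono` / `CDgk_scale` — p38's line-3 constant is monotone in `(θ₂, K_x)` and `C_D(s·K_x) ≤ s⁶·C_D(K_x)` for `s ≥ 1` (degree 6 in `K_x`).
* `pow_mul_exp_neg_le` / `poly_exp_absorb` — `x^q·e^{−2cx} ≤ q!·c^{−q}·e^{−cx}` and `(1 + A x^p)⁶·e^{−2cx} ≤ (1 + A)⁶(6p)!c^{−6p}·e^{−cx}` (`x ≥ 1`): the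
  polynomial block count of the member torus is absorbed into half of the exponential smallness (print's *"O(M⁻¹)"*, here `e^{−cM}`).

## HONEST SCOPE / DIVERGENCES

(1) The profile constant is p29/p21's `K261` of the torus Lemma 2.1 in reading R2 of (2.46) (G-B6-22), not print's `c₁(α)` (refuted as typed, B6.Lem2.1
cells).  (2) Pure bookkeeping; NOT summit progress.
-/

open scoped BigOperators

namespace Literature.MathematicalPhysics.QuantumFieldTheory.Balaban1983to89.B6Line3ProfileV1

open Finset
open B6MultiLevelTorusOperator (TDomains)
open B6Geom246MultiLevelBox (bset)
open B6Geom246MultiLevelTorus (geomT lemma21_torus)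
open B8Ineq192MultiLevelTorus (geomTB geomTB_dist)
open B6Ineq261LevelGap (K261 K261_nonneg)
open B6DomainChange (Profile)
open B6DomainChangeP2134Sizes (CDgk CDtot CDgk_nonneg)

noncomputable section

variable {d : ℕ} {ℓ Mh k R : ℕ} {P : Fin (d + 1) → ℕ}

/-! ## §1  The (2.59)-shape budget at a fixed rate -/

/-- **THE BUDGET AT RATE `a₀`**: `e^{−a₀}·L^{2(d+1)/N₃} < 1` for `N₃ := ⌈2(d+1)·log L/a₀⌉₊ + 1` (`a₀ > 0`). [cite: Balaban1984PropagatorsII, (2.59) p.233 («δ₀RM > 16d log c₀ + 1» shape); bookkeeping ours] -/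
theorem budget_of_rate (d ℓ : ℕ) {a₀ : ℝ} (ha₀ : 0 < a₀) :
    Real.exp (-(1 * a₀)) * ((ℓ : ℝ) + 1) ^ ((2 * (d + 1 : ℕ) : ℝ) / (⌈2 * ((d : ℝ) + 1) * Real.log ((ℓ : ℝ) + 1) / a₀⌉₊ + 1 : ℕ)) < 1 := by
  have hL : (0 : ℝ) < (ℓ : ℝ) + 1 := by positivity
  have hlog : 0 ≤ Real.log ((ℓ : ℝ) + 1) := Real.log_nonneg (by linarith [(Nat.cast_nonneg ℓ : (0 : ℝ) ≤ ℓ)])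
  have hN : 2 * ((d : ℝ) + 1) * Real.log ((ℓ : ℝ) + 1) / a₀ < ((⌈2 * ((d : ℝ) + 1) * Real.log ((ℓ : ℝ) + 1) / a₀⌉₊ + 1 : ℕ) : ℝ) := by
    push_cast
    exact lt_of_le_of_lt (Nat.le_ceil _) (lt_add_one _)
  have hNpos : (0 : ℝ) < ((⌈2 * ((d : ℝ) + 1) * Real.log ((ℓ : ℝ) + 1) / a₀⌉₊ + 1 : ℕ) : ℝ) := by positivity
  have key : (2 * (d + 1 : ℕ) : ℝ) / (⌈2 * ((d : ℝ) + 1) * Real.log ((ℓ : ℝ) + 1) / a₀⌉₊ + 1 : ℕ) * Real.log ((ℓ : ℝ) + 1) < a₀ := by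
    rw [div_mul_eq_mul_div, div_lt_iff₀ hNpos]
    rw [div_lt_iff₀ ha₀] at hN
    push_cast at hN ⊢
    nlinarith
  rw [one_mul, Real.rpow_def_of_pos hL, ← Real.exp_add, Real.exp_lt_one_iff]
  nlinarith

/-! ## §2  The torus profile from Lemma 2.1 -/

variable (D : TDomains d ℓ Mh k P R)

/-- **THE TORUS PROFILE `K_p` FROM LEMMA 2.1 (2.61)**: with `K := K₂₆₁(N₀, d+1, L, 1, a₀)` of the torus Lemma 2.1 at rate `a₀` (budget
`e^{−a₀}L^{2(d+1)/N₀} < 1`, `N₀ + 1 ≤ R·(L·M_h)`), the step function `K_p(a) = K` (`a ≥ a₀`), `= max(K, #𝔅)` (`a < a₀`) satisfies: every block sum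
`Σ_b e^{−a d_T(s,b)} ≤ K_p(a)` (`a > 0`), `K_p ≥ 0`, `K_p` antitone — the binders `hPrT`, `hKp0`, `hKanti` of the line-3 window theorem.
[cite: Balaban1984PropagatorsII, Lemma 2.1 (2.61) p.234; bookkeeping ours] -/
theorem profile_torus (hMh : 1 ≤ Mh) (hP : ∀ μ, 1 ≤ P μ) {N₀ : ℕ} (hN₀ : 0 < N₀) (hRM : N₀ + 1 ≤ R * ((ℓ + 1) * Mh)) {a₀ : ℝ} (ha₀ : 0 < a₀)
    (hθ : Real.exp (-(1 * a₀)) * ((ℓ : ℝ) + 1) ^ ((2 * (d + 1 : ℕ) : ℝ) / N₀) < 1) :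
    Profile (geomTB D).dist (fun a : ↥(bset D.toDomains) => a)
        (fun a => if a₀ ≤ a then K261 N₀ (d + 1) ((ℓ : ℝ) + 1) 1 (1 * a₀)
          else max (K261 N₀ (d + 1) ((ℓ : ℝ) + 1) 1 (1 * a₀)) (Fintype.card ↥(bset D.toDomains))) ∧
      (∀ a : ℝ, 0 < a → 0 ≤ (if a₀ ≤ a then K261 N₀ (d + 1) ((ℓ : ℝ) + 1) 1 (1 * a₀)
          else max (K261 N₀ (d + 1) ((ℓ : ℝ) + 1) 1 (1 * a₀)) (Fintype.card ↥(bset D.toDomains)))) ∧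
      (∀ a b : ℝ, 0 < a → a ≤ b →
        (if a₀ ≤ b then K261 N₀ (d + 1) ((ℓ : ℝ) + 1) 1 (1 * a₀)
          else max (K261 N₀ (d + 1) ((ℓ : ℝ) + 1) 1 (1 * a₀)) (Fintype.card ↥(bset D.toDomains))) ≤
        (if a₀ ≤ a then K261 N₀ (d + 1) ((ℓ : ℝ) + 1) 1 (1 * a₀)
          else max (K261 N₀ (d + 1) ((ℓ : ℝ) + 1) 1 (1 * a₀)) (Fintype.card ↥(bset D.toDomains)))) := by
  set K : ℝ := K261 N₀ (d + 1) ((ℓ : ℝ) + 1) 1 (1 * a₀) with hK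
  have hK0 : 0 ≤ K := K261_nonneg (by positivity) zero_le_one
  -- Lemma 2.1 (2.61) on the torus at `α = 1`, `δ₀ = a₀`
  obtain ⟨-, h261, -, -⟩ := lemma21_torus (D := D) hMh hP hN₀ hRM ha₀.le zero_le_one le_rfl hθ
  have hd0 : ∀ s b : ↥(bset D.toDomains), 0 ≤ (geomTB D).dist s b := fun s b => by rw [geomTB_dist]; exact Nat.cast_nonneg _
  refine ⟨fun a ha s => ?_, fun a _ => ?_, fun a b ha hab => ?_⟩
  · show ∑ b : ↥(bset D.toDomains), Real.exp (-(a * (geomTB D).dist s b)) ≤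
      (if a₀ ≤ a then K else max K (Fintype.card ↥(bset D.toDomains) : ℝ))
    have hd0' : ∀ b : ↥(bset D.toDomains), 0 ≤ (geomTB D).dist s b := fun b => hd0 s b
    by_cases h : a₀ ≤ a
    · rw [if_pos h]
      calc ∑ b : ↥(bset D.toDomains), Real.exp (-(a * (geomTB D).dist s b))
          ≤ ∑ b : ↥(bset D.toDomains), Real.exp (-(1 * a₀ * (geomT D).dist s b)) :=
            Finset.sum_le_sum fun b _ => Real.exp_le_exp.2 (by
              have e : (geomT D).dist s b = (geomTB D).dist s b := rfl
              rw [e]; nlinarith [hd0' b])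
        _ ≤ K := h261 s
    · rw [if_neg h]
      calc ∑ b : ↥(bset D.toDomains), Real.exp (-(a * (geomTB D).dist s b)) ≤ ∑ _b : ↥(bset D.toDomains), (1 : ℝ) :=
            Finset.sum_le_sum fun b _ => by rw [Real.exp_le_one_iff]; nlinarith [hd0' b]
        _ = Fintype.card ↥(bset D.toDomains) := by simp
        _ ≤ max K (Fintype.card ↥(bset D.toDomains)) := le_max_right _ _
  · split_ifs
    · exact hK0
    · exact le_max_of_le_left hK0
  · by_cases hb : a₀ ≤ b
    · rw [if_pos hb]
      split_ifs
      · exact le_rfl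
      · exact le_max_left _ _
    · have ha' : ¬ a₀ ≤ a := fun h => hb (h.trans hab)
      rw [if_neg hb, if_neg ha']

/-! ## §3  The line-3 constant is monotone and of degree six in the profile bound -/

/-- **`C_D` IS MONOTONE** in the commutator-leg size `θ₂` and the profile bound `K_x` (all constants non-negative). [cite: Balaban1984PropagatorsII, p.238; bookkeeping ours] -/
theorem CDgk_mono {Λ B₁ BS C₁ θ θ₂ θ₂' Kx Kx' : ℝ} (hΛ : 0 ≤ Λ) (hB₁ : 0 ≤ B₁) (hBS : 0 ≤ BS) (hC₁ : 0 ≤ C₁) (hθ : 0 ≤ θ)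
    (hθ₂ : 0 ≤ θ₂) (hKx : 0 ≤ Kx) (h₂ : θ₂ ≤ θ₂') (hK : Kx ≤ Kx') :
    CDgk Λ B₁ BS C₁ θ θ₂ Kx ≤ CDgk Λ B₁ BS C₁ θ θ₂' Kx' := by
  have hθ₂' : 0 ≤ θ₂' := hθ₂.trans h₂
  unfold CDgk CDtot
  gcongr

/-- **`C_D` HAS DEGREE SIX IN `K_x`**: `C_D(s·K_x) ≤ s⁶·C_D(K_x)` for `s ≥ 1`. [cite: Balaban1984PropagatorsII, p.238; bookkeeping ours] -/
theorem CDgk_scale {Λ B₁ BS C₁ θ θ₂ Kx s : ℝ} (hΛ : 0 ≤ Λ) (hB₁ : 0 ≤ B₁) (hBS : 0 ≤ BS) (hC₁ : 0 ≤ C₁) (hθ : 0 ≤ θ) (hθ₂ : 0 ≤ θ₂)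
    (hKx : 0 ≤ Kx) (hs : 1 ≤ s) :
    CDgk Λ B₁ BS C₁ θ θ₂ (s * Kx) ≤ s ^ 6 * CDgk Λ B₁ BS C₁ θ θ₂ Kx := by
  have hs0 : 0 ≤ s := le_trans zero_le_one hs
  have p2 : (s * Kx) ^ 2 ≤ s ^ 6 * Kx ^ 2 := by
    rw [mul_pow]; exact mul_le_mul_of_nonneg_right (pow_le_pow_right₀ hs (by norm_num)) (by positivity)
  have p3 : (s * Kx) ^ 3 ≤ s ^ 6 * Kx ^ 3 := by
    rw [mul_pow]; exact mul_le_mul_of_nonneg_right (pow_le_pow_right₀ hs (by norm_num)) (by positivity)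
  have p5 : (s * Kx) ^ 5 ≤ s ^ 6 * Kx ^ 5 := by
    rw [mul_pow]; exact mul_le_mul_of_nonneg_right (pow_le_pow_right₀ hs (by norm_num)) (by positivity)
  have p6 : (s * Kx) ^ 6 = s ^ 6 * Kx ^ 6 := by rw [mul_pow]
  have c1 : 0 ≤ 2 * Λ ^ 7 * θ * BS * C₁ ^ 2 := by positivity
  have c2 : 0 ≤ 2 * Λ ^ 12 * θ * B₁ ^ 2 * BS ^ 2 * C₁ ^ 2 := by positivity
  have c3 : 0 ≤ 2 * Λ ^ 9 * B₁ ^ 2 * BS ^ 2 * C₁ ^ 2 := by positivity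
  have c4 : 0 ≤ 2 * Λ ^ 10 * θ * B₁ ^ 2 * BS ^ 2 * C₁ ^ 2 := by positivity
  have c6 : 0 ≤ 2 * Λ ^ 5 * (0 : ℝ) * B₁ * BS * C₁ := by positivity
  have c7 : 0 ≤ 2 * Λ ^ 4 * BS * C₁ ^ 2 := by positivity
  have c8 : 0 ≤ 2 * Λ ^ 5 * BS * C₁ ^ 2 * θ₂ := by positivity
  unfold CDgk CDtot
  rw [p6]
  nlinarith [mul_le_mul_of_nonneg_left p3 c1, mul_le_mul_of_nonneg_left p5 c3, mul_le_mul_of_nonneg_left p3 c6,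
    mul_le_mul_of_nonneg_left p2 c7, mul_le_mul_of_nonneg_left p3 c8]

/-! ## §4  Polynomial growth absorbed into half of an exponential decay -/

/-- **`x^q·e^{−2cx} ≤ q!·c^{−q}·e^{−cx}`** (`x ≥ 0`, `c > 0`). [cite: Balaban1984PropagatorsII, p.238 («gives a factor O(M⁻¹)»); real-variable bookkeeping ours] -/
theorem pow_mul_exp_neg_le {x c : ℝ} (hx : 0 ≤ x) (hc : 0 < c) (q : ℕ) :
    x ^ q * Real.exp (-(2 * c * x)) ≤ (q.factorial : ℝ) / c ^ q * Real.exp (-(c * x)) := by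
  have h := Real.pow_div_factorial_le_exp (c * x) (by positivity) q
  have hq : (0 : ℝ) < q.factorial := by exact_mod_cast Nat.factorial_pos q
  rw [div_le_iff₀ hq, mul_pow] at h
  -- `x^q ≤ q!·c^{−q}·e^{cx}`
  have hcq : (0 : ℝ) < c ^ q := by positivity
  have h1 : x ^ q ≤ (q.factorial : ℝ) / c ^ q * Real.exp (c * x) := by
    rw [div_mul_eq_mul_div, le_div_iff₀ hcq]
    nlinarith
  have e : Real.exp (-(2 * c * x)) = Real.exp (-(c * x)) * Real.exp (-(c * x)) := by
    rw [← Real.exp_add]; congr 1; ring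
  rw [e, ← mul_assoc]
  refine mul_le_mul_of_nonneg_right ?_ (Real.exp_nonneg _)
  calc x ^ q * Real.exp (-(c * x)) ≤ (q.factorial : ℝ) / c ^ q * Real.exp (c * x) * Real.exp (-(c * x)) :=
        mul_le_mul_of_nonneg_right h1 (Real.exp_nonneg _)
    _ = (q.factorial : ℝ) / c ^ q := by rw [mul_assoc, ← Real.exp_add]; simp

/-- **THE POLYNOMIAL BLOCK COUNT IS ABSORBED**: `(1 + A·x^p)⁶·e^{−2cx} ≤ (1 + A)⁶·(6p)!·c^{−6p}·e^{−cx}` for `x ≥ 1`, `A ≥ 0`, `c > 0`.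
[cite: Balaban1984PropagatorsII, p.238 («gives a factor O(M⁻¹)»); real-variable bookkeeping ours] -/
theorem poly_exp_absorb {x A c : ℝ} (hx : 1 ≤ x) (hA : 0 ≤ A) (hc : 0 < c) (p : ℕ) :
    (1 + A * x ^ p) ^ 6 * Real.exp (-(2 * c * x)) ≤ (1 + A) ^ 6 * (((6 * p).factorial : ℝ) / c ^ (6 * p)) * Real.exp (-(c * x)) := by
  have hx0 : 0 ≤ x := le_trans zero_le_one hx
  have hxp : 1 ≤ x ^ p := one_le_pow₀ hx
  -- `1 + A x^p ≤ (1 + A) x^p`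
  have h1 : 1 + A * x ^ p ≤ (1 + A) * x ^ p := by nlinarith
  have h2 : (1 + A * x ^ p) ^ 6 ≤ ((1 + A) * x ^ p) ^ 6 := pow_le_pow_left₀ (by positivity) h1 6
  rw [mul_pow, ← pow_mul, mul_comm p 6] at h2
  have h3 := pow_mul_exp_neg_le hx0 hc (6 * p)
  calc (1 + A * x ^ p) ^ 6 * Real.exp (-(2 * c * x)) ≤ (1 + A) ^ 6 * x ^ (6 * p) * Real.exp (-(2 * c * x)) :=
        mul_le_mul_of_nonneg_right h2 (Real.exp_nonneg _)
    _ = (1 + A) ^ 6 * (x ^ (6 * p) * Real.exp (-(2 * c * x))) := by ring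
    _ ≤ (1 + A) ^ 6 * (((6 * p).factorial : ℝ) / c ^ (6 * p) * Real.exp (-(c * x))) := mul_le_mul_of_nonneg_left h3 (by positivity)
    _ = _ := by ring

end

end Literature.MathematicalPhysics.QuantumFieldTheory.Balaban1983to89.B6Line3ProfileV1
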